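import Mathlib
import HarnessLib

/-!
# Stub `stub_periodSymmetry` — crux `TorsionLogs.NeronTorsionSector`, line `registered` (block U2)

Pure combinatorics. For a real sequence `qq`, `n`-periodic and reflection-symmetric
(`qq i = qq (n − 1 − i)` for `i < n`), with `n = 2m`, `aa < m` and `q(m − aa) = 2pm`, the explicit
combination of partial sums of `qq` that multiplies the Haar-length period after the integer
elimination of the torsion-sector bookkeeping vanishes.

Proof. Three elementary facts:

* summation by parts (valid for every sequence, no symmetry needed): with `r := m − aa`,
  `2 Σ_{aa ≤ j < m} Σ_{i<j} qq (i+1) + 2 Σ_{aa ≤ j < m} (j − aa)(qq j − qq 0)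
    = 2 r Σ_{i<m} qq i − r (r+1) qq 0` (induction on `m ≥ aa`);
* the reflection symmetry folds the full sum: `Σ_{i<2m} qq i = 2 Σ_{i<m} qq i`;
* periodicity gives `qq n = qq 0`, so the shifted sums over `range (n−1)` and `range n` are the full
  sum minus `qq 0`, resp. the full sum.

After these substitutions the statement is `q²/2 ×` (a polynomial identity that holds by
`q(m − aa) = 2pm`), closed by `linear_combination`.

References: M. Kontsevich, D. Zagier, *Periods* (2001), §1.2 (context only; the lemma is
self-contained finite-sum algebra).
-/

-- `Summit.KontsevichZagierPeriods.KontsevichZagierPeriods.…` is the tree's mandated layout (single-conjunct summit).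
set_option linter.dupNamespace false

namespace Summit.KontsevichZagierPeriods.KontsevichZagierPeriods.Cruxes.NeronTorsionSector.Translation

/-- **Summation by parts for the torsion-sector partial sums** (any real sequence `s`, `aa ≤ m`):
`2 Σ_{aa ≤ j < m} Σ_{i<j} s (i+1) + 2 Σ_{aa ≤ j < m} (j − aa)(s j − s 0)
  = 2 (m − aa) Σ_{i<m} s i − (m − aa)(m − aa + 1) s 0`.
Induction on `m` from `aa` (`Nat.le_induction`), peeling the top term of each `Ico`-sum. -/
theorem periodSymmetry_sum_by_parts (s : ℕ → ℝ) (aa m : ℕ) (hm : aa ≤ m) :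
    2 * (∑ j ∈ Finset.Ico aa m, ∑ i ∈ Finset.range j, s (i + 1))
        + 2 * ∑ j ∈ Finset.Ico aa m, ((j : ℝ) - (aa : ℝ)) * (s j - s 0)
      = 2 * ((m : ℝ) - (aa : ℝ)) * ∑ i ∈ Finset.range m, s i
        - ((m : ℝ) - (aa : ℝ)) * ((m : ℝ) - (aa : ℝ) + 1) * s 0 := by
  induction m, hm using Nat.le_induction with
  | base => simp
  | succ k hk ih =>
    rw [Finset.sum_Ico_succ_top hk, Finset.sum_Ico_succ_top hk, Finset.sum_range_succ]
    have h1 : ∑ i ∈ Finset.range k, s (i + 1) = (∑ i ∈ Finset.range k, s i) + s k - s 0 := by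
      have e1 := Finset.sum_range_succ' s k
      have e2 := Finset.sum_range_succ s k
      linarith
    rw [h1]
    push_cast
    linear_combination ih

/-- **Reflection symmetry folds the full sum**: if `s i = s (2m − 1 − i)` for all `i < 2m`, then
`Σ_{i<2m} s i = 2 Σ_{i<m} s i` (split `range (m + m)` and reflect the upper half with
`Finset.sum_range_reflect`). -/
theorem periodSymmetry_sum_fold (s : ℕ → ℝ) (m : ℕ)
    (hsym : ∀ i, i < 2 * m → s i = s (2 * m - 1 - i)) :
    ∑ i ∈ Finset.range (2 * m), s i = 2 * ∑ i ∈ Finset.range m, s i := by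
  rw [two_mul m, Finset.sum_range_add, two_mul (∑ i ∈ Finset.range m, s i)]
  congr 1
  calc ∑ i ∈ Finset.range m, s (m + i) = ∑ i ∈ Finset.range m, s (m - 1 - i) := by
        refine Finset.sum_congr rfl fun i hi => ?_
        rw [Finset.mem_range] at hi
        rw [hsym (m + i) (by omega), show 2 * m - 1 - (m + i) = m - 1 - i from by omega]
    _ = ∑ i ∈ Finset.range m, s i := Finset.sum_range_reflect s m

/-- **STUB U2 (`stub_periodSymmetry`) — the period coefficient vanishes.** For a real sequence `qq`,
`n`-periodic and symmetric `qq i = qq (n−1−i)` (`i < n`), with `n = 2m`, `aa < m`, `q(m − aa) = 2pm`,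
the explicit combination of partial sums that multiplies the Haar-length representation after the
integer elimination of the torsion-sector bookkeeping is `0`. Proof: summation by parts
(`periodSymmetry_sum_by_parts`), the symmetric fold `Σ_{i<n} qq i = 2 Σ_{i<m} qq i`
(`periodSymmetry_sum_fold`), `qq n = qq 0` (periodicity) for the two shifted sums, and a final
`linear_combination` using `q(m − aa) = 2pm`.
[cite: KontsevichZagier2001, §1.2] -/
theorem stub_periodSymmetry (n m aa : ℕ) (p q : ℤ) (qq : ℕ → ℝ) (hn : n = 2 * m) (haa : aa < m)
    (hpq : (q : ℝ) * ((m : ℝ) - (aa : ℝ)) = 2 * (p : ℝ) * (m : ℝ))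
    (hper : ∀ k, qq (k + n) = qq k) (hsym : ∀ i, i < n → qq i = qq (n - 1 - i)) :
    -((q : ℝ) ^ 2) * ∑ j ∈ Finset.Ico aa m, ∑ i ∈ Finset.range j, qq (i + 1)
      - ((q : ℝ) ^ 2) * ∑ j ∈ Finset.Ico aa m, ((j : ℝ) - (aa : ℝ)) * (qq j - qq 0)
      + (2 * (p : ℝ) ^ 2 * (m : ℝ)) * ∑ j ∈ Finset.range m, (qq j - qq 0)
      + ((p : ℝ) * (q : ℝ) * (m : ℝ)) * ∑ i ∈ Finset.range (n - 1), qq (i + 1)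
      - ((p : ℝ) ^ 2 * (m : ℝ)) * ∑ i ∈ Finset.range n, qq (i + 1) = 0 := by
  subst hn
  have hBC := periodSymmetry_sum_by_parts qq aa m haa.le
  have hhalf := periodSymmetry_sum_fold qq m hsym
  have hn0 : qq (2 * m) = qq 0 := by simpa using hper 0
  have hF : ∑ i ∈ Finset.range (2 * m), qq (i + 1) = 2 * ∑ i ∈ Finset.range m, qq i := by
    have e1 := Finset.sum_range_succ' qq (2 * m)
    have e2 := Finset.sum_range_succ qq (2 * m)
    linarith
  have hE : ∑ i ∈ Finset.range (2 * m - 1), qq (i + 1)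
      = 2 * (∑ i ∈ Finset.range m, qq i) - qq 0 := by
    have e1 := Finset.sum_range_succ' qq (2 * m - 1)
    have e2 : 2 * m - 1 + 1 = 2 * m := by omega
    rw [e2] at e1
    linarith
  have hD : ∑ j ∈ Finset.range m, (qq j - qq 0)
      = (∑ i ∈ Finset.range m, qq i) - (m : ℝ) * qq 0 := by
    rw [Finset.sum_sub_distrib, Finset.sum_const, Finset.card_range, nsmul_eq_mul]
  linear_combination (2 * (p : ℝ) ^ 2 * (m : ℝ)) * hD + ((p : ℝ) * (q : ℝ) * (m : ℝ)) * hE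
    - ((p : ℝ) ^ 2 * (m : ℝ)) * hF - ((q : ℝ) ^ 2 / 2) * hBC
    + (-(q : ℝ) * (∑ i ∈ Finset.range m, qq i)
        + qq 0 * ((q : ℝ) * ((m : ℝ) - (aa : ℝ)) + 2 * (p : ℝ) * (m : ℝ) + (q : ℝ)) / 2) * hpq

end Summit.KontsevichZagierPeriods.KontsevichZagierPeriods.Cruxes.NeronTorsionSector.Translation
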